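import Mathlib.FieldTheory.IsAlgClosed.Classification
import Mathlib.Analysis.Complex.Cardinality
import Mathlib.Analysis.Complex.Polynomial.Basic
import Mathlib.Algebra.Algebra.Hom.Rat
import HarnessLib

/-!
# Automorphisms of `ℂ` act transitively on the complex embeddings of a countable field (Zarhin's theorem, step 8a)

For a countable field `F` and two ring embeddings `σ₀, σ : F → ℂ` there is a field automorphism
`τ` of `ℂ` with `τ ∘ σ₀ = σ` (`exists_ringEquiv_complex_comp_eq`). Proof: `ℂ` is an algebraic
closure of a purely transcendental extension of `σ₀(F)` resp. `σ(F)` with transcendence bases of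
the same cardinality `#ℂ` (`IsAlgClosed.cardinal_eq_cardinal_transcendence_basis_of_aleph0_lt`);
the corresponding isomorphism of polynomial algebras over `F` extends to the algebraic closures
(`IsAlgClosure.equivOfEquiv`), compatibly with the structure maps
(`IsAlgClosure.equivOfEquiv_algebraMap`). This is the construction of Mathlib's
`IsAlgClosed.equivOfTranscendenceBasis`, which however only records the bare ring isomorphism;
here the compatibility with the `F`-algebra structures is kept (`exists_ringEquiv_algebraMap_eq`).

In the tree's proof of Zarhin's theorem on the Hodge group of a Hodge structure of K3 type
(Huybrechts, *Lectures on K3 Surfaces*, Thm. 3.3.9; Zarhin 1983, §2) this replaces the Galois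
action on the eigenspaces `T_σ` of the endomorphism field: the Hodge group being defined over `ℚ`,
`Aut(ℂ)` permutes the blocks of `Lie(Hdg)_ℂ` transitively. No definitions, no named facts.

## References

* N. Bourbaki, *Algèbre*, Ch. V §14 no. 6, Cor. 2 (extension of isomorphisms to algebraically
  closed extensions of equal transcendence degree).
* Yu. G. Zarhin, *Hodge groups of K3 surfaces*, J. reine angew. Math. 341 (1983), §2.
-/

noncomputable section

open Cardinal

namespace Literature.AlgebraicGeometry.Motives

namespace ZarhinLie

universe u v w

/-- **Isomorphism of algebraically closed extensions with equipotent transcendence bases,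
compatible with the base field** (the construction of `IsAlgClosed.equivOfTranscendenceBasis`,
keeping track of the structure maps). [folklore] -/
theorem exists_ringEquiv_algebraMap_eq {F : Type u} {K : Type v} {L : Type w} [Field F] [Field K]
    [Field L] [Algebra F K] [Algebra F L] [IsAlgClosed K] [IsAlgClosed L] {ι : Type*} {κ : Type*}
    (x : ι → K) (y : κ → L) (e : ι ≃ κ) (hx : IsTranscendenceBasis F x)
    (hy : IsTranscendenceBasis F y) :
    ∃ f : K ≃+* L, ∀ a : F, f (algebraMap F K a) = algebraMap F L a := by
  letI := IsAlgClosed.isAlgClosure_of_transcendence_basis x hx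
  letI := IsAlgClosed.isAlgClosure_of_transcendence_basis y hy
  -- the `F`-algebra isomorphism of the polynomial subalgebras
  let g : Algebra.adjoin F (Set.range x) ≃ₐ[F] Algebra.adjoin F (Set.range y) :=
    hx.1.aevalEquiv.symm.trans
      ((MvPolynomial.renameEquiv F e).trans hy.1.aevalEquiv)
  refine ⟨IsAlgClosure.equivOfEquiv K L g.toRingEquiv, fun a => ?_⟩
  have h1 : algebraMap F K a = algebraMap (Algebra.adjoin F (Set.range x)) K
      (algebraMap F (Algebra.adjoin F (Set.range x)) a) := (IsScalarTower.algebraMap_apply _ _ _ a)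
  rw [h1, IsAlgClosure.equivOfEquiv_algebraMap]
  change algebraMap (Algebra.adjoin F (Set.range y)) L (g (algebraMap F _ a)) = _
  rw [AlgEquiv.commutes, ← IsScalarTower.algebraMap_apply]

/-- **`Aut(ℂ)` acts transitively on the embeddings of a countable field into `ℂ`**: for ring
homomorphisms `σ₀, σ : F → ℂ` of a countable field `F` there is a field automorphism `τ` of `ℂ`
with `τ (σ₀ a) = σ a` for all `a` (transcendence bases of `ℂ` over `σ₀(F)` and over `σ(F)` both
have cardinality `#ℂ`). [folklore] -/
theorem exists_ringEquiv_complex_comp_eq {F : Type u} [Field F] [Countable F] (σ₀ σ : F →+* ℂ) :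
    ∃ τ : ℂ ≃+* ℂ, ∀ a : F, τ (σ₀ a) = σ a := by
  have hF : #F ≤ ℵ₀ := Cardinal.mk_le_aleph0
  have hC : ℵ₀ < #ℂ := by rw [Cardinal.mk_complex]; exact Cardinal.aleph0_lt_continuum
  -- transcendence bases of `ℂ` for the two `F`-algebra structures
  have key : ∀ ρ : F →+* ℂ, ∃ s : Set ℂ, @IsTranscendenceBasis s F ℂ _ _ ρ.toAlgebra Subtype.val ∧
      #s = #ℂ := by
    intro ρ
    letI : Algebra F ℂ := ρ.toAlgebra
    haveI : FaithfulSMul F ℂ := (faithfulSMul_iff_algebraMap_injective F ℂ).2 ρ.injective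
    obtain ⟨s, hs⟩ := exists_isTranscendenceBasis F ℂ
    refine ⟨s, hs, ?_⟩
    have h := IsAlgClosed.cardinal_eq_cardinal_transcendence_basis_of_aleph0_lt
      (Subtype.val : s → ℂ) hs hF hC
    simpa using h.symm
  obtain ⟨s₀, hs₀, hc₀⟩ := key σ₀
  obtain ⟨s₁, hs₁, hc₁⟩ := key σ
  obtain ⟨e⟩ : Nonempty (s₀ ≃ s₁) := Cardinal.eq.1 (hc₀.trans hc₁.symm)
  obtain ⟨τ, hτ⟩ := @exists_ringEquiv_algebraMap_eq F ℂ ℂ _ _ _ σ₀.toAlgebra σ.toAlgebra _ _ _ _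
    Subtype.val Subtype.val e hs₀ hs₁
  exact ⟨τ, hτ⟩

end ZarhinLie

end Literature.AlgebraicGeometry.Motives

end
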